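import Mathlib
import Summits.ValiantsHypothesis.ValiantsHypothesis.Theorems.NewtonUnitEquationsTwoProductsFormalLogLinearisationDefs
import HarnessLib

/-!
# Crux `TwoProducts` (stmt-ValiantsHypothesis-5906): base-2 ROW COINCIDENCE fails on a 3-digit identity box

Negative lane (val-neg-1 g8 = refuter-val-neg-1-g7-0, 2026-08-29; exact companion of the RIGID-BOX run j322825
commissioned by director-valiant R337 (1)(b) on val-idea-crit-8 g3's spec of 01:46:24Z, VERDICT #25 context).

SETTING.  The crux workfile `Cruxes/TwoProducts/SubboxCascade_val_idea_34_g10.lean` (val-idea-34, card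
`subbox-congruence-cascade`) proves the TRUNCATED CONGRUENCE (L1): below an LL-visible vertex `p` of
`∏(1+u_j) − ∏(1+v_j)` every coordinate box `[0,N)×[0,M)` under `p` is an identity box
(`∏(1+u_j^B) ≡ ∏(1+v_j^B) mod (X^N,Y^M)`), and TYPES the conjectured base-2 RIGIDITY as the hypothesis
`RowCoincidenceBelowLL u v` of its target `DigitGridLLLawGivenRigidity` (U1′): the truncated rows `{u_j^B}`, `{v_j^B}`
COINCIDE AS MULTISETS.  In base `β ≥ m+1` this is UFD; in base 2 the card claims it for boxes with `≥ 3` binary digits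
per side at generic rows (tangent kernel `0`) and hedges "up to the thick hook"; crit-8's pre-registered RIGID-BOX key
(STATUS 01:46:24Z) predicted 100 % coincidence of the truncated rows in the wild for classes `min(a*,b*) ≥ 3`.

THIS FILE (0 sorry, no new facts, definitions `boxTrunc` / `DigitGrid` / `llVisible` copied VERBATIM from the workfile,
ll.32/150/156, so that no `Cruxes/` module is imported):

* `threeDigitBox_witness` — the explicit digit-grid instance `s = 4`, `m = 2`
  `1 + u = (1 + 3X^t + X^e, 1 − X^t + 2X^e)`, `1 + v = (1 + X^t + X^e, 1 + X^t + 2X^e)`, `t = (2²,2²)`, `e = (2³,2⁰)`: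
  `∏(1+u) − ∏(1+v) = 2X^{t+e} − 4X^{2t}` (`tailDiff_eq`, by `ring`), so `p = 2t = (2³,2³)` is LL-visible
  (strict `ξ`-top for `ξ = (−1,−1)`, `pp_mem_llVisible`), its dyadic class is `(3,3)`, the 3-digit box `[0,2³)²` lies
  below `p`, is an identity box by L1 — and its truncated rows `{3X^t, −X^t}` vs `{X^t, X^t}` are NOT equal as multisets
  (not even projectively: `truncated_rows_ne`).
* `not_rowCoincidence_on_digitGrid` — hence `∀ γ1-instances, RowCoincidenceBelowLL` (unfolded verbatim) is FALSE:
  the hypothesis of (U1′) is violated by base-2 digit-grid instances at a 3-digit box, so (U1′) as typed does not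
  cover base 2 (it is silent on such instances).

MECHANISM (the general family, exact over `ℚ`, `efamily.py` sha 838aaba902e61261 of the RIGID-BOX prereg; dense rows,
every `s ≥ 4`, `m ∈ {2,3,4}`, classes `(3,b*)`, `3 ≤ b* ≤ s−1`): if the rows are PROPORTIONAL on the box minus its top
digit column `x = 2^{a*−1}` (`g_j = c_j·h` there), then `f_j = g_j + τ_j X^{(2^{a*−1}, y)}` with `Σ_j τ_j ∏_{i≠j} c_i = 0`
solves the truncated congruence: the carry `2^{a*−1} + 2^{a*−1} = 2^{a*}` pushes every `τ`-quadratic and every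
`τ·(top column)` term out of the box.  Sparse rows (zero off the top column, as here) are the extreme case of
proportionality.  At GENERIC rows the identity solution IS infinitesimally rigid (tangent excess `0` with both sides
free, boxes `(3,3)…(5,5)`, `m = 2,3`, bases 2 and 3 — reproducing the card's table), so what fails is only the
unhedged law; the deformation lives in the top digit column/row of the box (the card's "thick hook").

HONEST FRAME: L1 (kernel theorem of the workfile), generic rigidity, `DigitGridTwoProducts`, `DigitGridLLLaw`, the crux
`TwoProducts`, `ResidualLawV25` and `VP ≠ VNP` are UNTOUCHED (OPEN / NOT proved).  This is a negative lemma on the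
rigidity HYPOTHESIS as typed, not a refutation of any Theses statement. [folklore]
-/

noncomputable section

set_option linter.dupNamespace false

open scoped BigOperators
open MvPolynomial
open Summit.ValiantsHypothesis.ValiantsHypothesis.Theorems.NewtonUnitEquations.TwoProducts.FormalLogLinearisation

namespace Summit.ValiantsHypothesis.ValiantsHypothesis.Theorems.NewtonUnitEquations.TwoProducts.Negative.RowCoincidence

/-- Box truncation (verbatim `SubboxCascade.boxTrunc`, `Cruxes/TwoProducts/SubboxCascade_val_idea_34_g10.lean` l.32). -/
def boxTrunc (N M : ℕ) (p : MvPolynomial (Fin 2) ℂ) : MvPolynomial (Fin 2) ℂ :=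
  ∑ e ∈ p.support.filter (fun e => e 0 < N ∧ e 1 < M), monomial e (coeff e p)

/-- The digit grid (verbatim `SubboxCascade.DigitGrid`, l.150). -/
def DigitGrid (s : ℕ) : Set Expo :=
  {e | ∃ a b : ℕ, a < s ∧ b < s ∧ e 0 = 2 ^ a ∧ e 1 = 2 ^ b}

/-- LL-visible points (verbatim `SubboxCascade.llVisible`, l.156). -/
def llVisible {m : ℕ} (u v : Fin m → MvPolynomial (Fin 2) ℂ) : Set Expo :=
  {l | ∃ ξ : Fin 2 → ℝ, ξ 0 < 0 ∧ ξ 1 < 0 ∧ ValidWeight u v ξ ∧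
    IsStrictTop ξ (↑(tailDiff u v).support : Set Expo) l}

/-- Coefficients of the box truncation (verbatim the workfile lemma). -/
theorem coeff_boxTrunc (N M : ℕ) (p : MvPolynomial (Fin 2) ℂ) (x : Expo) :
    coeff x (boxTrunc N M p) = if x 0 < N ∧ x 1 < M then coeff x p else 0 := by
  classical
  unfold boxTrunc
  rw [coeff_sum]
  simp only [coeff_monomial]
  rw [Finset.sum_ite_eq' (p.support.filter (fun e => e 0 < N ∧ e 1 < M)) x (fun e => coeff e p)]
  simp only [Finset.mem_filter, MvPolynomial.mem_support_iff]
  by_cases hx : x 0 < N ∧ x 1 < M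
  · by_cases hc : coeff x p = 0
    · simp [hx, hc]
    · simp [hx, hc]
  · simp [hx]

/-! ## The instance: `s = 4`, `m = 2`, letters `t = (4,4)` and `e = (8,1)` -/

/-- the deformed letter `t = (2²,2²)` (top digit column AND row of the 3-digit box). -/
def et : Expo := Finsupp.single 0 4 + Finsupp.single 1 4
/-- the outside letter `e = (2³,2⁰)`. -/
def ee : Expo := Finsupp.single 0 8 + Finsupp.single 1 1
/-- the LL-visible point `p = 2t = (8,8)`. -/
def pp : Expo := et + et

/-- `t₀ = 4`. -/
@[simp] theorem et_zero : et 0 = 4 := by simp [et]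
/-- `t₁ = 4`. -/
@[simp] theorem et_one : et 1 = 4 := by simp [et]
/-- `e₀ = 8`. -/
@[simp] theorem ee_zero : ee 0 = 8 := by simp [ee]
/-- `e₁ = 1`. -/
@[simp] theorem ee_one : ee 1 = 1 := by simp [ee]
/-- `p₀ = 8`. -/
@[simp] theorem pp_zero : pp 0 = 8 := by simp [pp]
/-- `p₁ = 8`. -/
@[simp] theorem pp_one : pp 1 = 8 := by simp [pp]

/-- `t ≠ e`. -/
theorem et_ne_ee : et ≠ ee := fun h => by have := congrArg (· 0) h; simp at this
/-- `2t ≠ t + e`. -/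
theorem pp_ne_etee : pp ≠ et + ee := fun h => by have := congrArg (· 0) h; simp at this

/-- a two-letter row `a·X^t + b·X^e`. -/
def row (a b : ℂ) : MvPolynomial (Fin 2) ℂ := monomial et a + monomial ee b

/-- Coefficients of a two-letter row. -/
theorem coeff_row (a b : ℂ) (x : Expo) :
    coeff x (row a b) = (if et = x then a else 0) + (if ee = x then b else 0) := by
  simp [row, coeff_monomial]

/-- tails `u = (3t + e, −t + 2e)`, `v = (t + e, t + 2e)` (so `1 + u_j`, `1 + v_j` are the factors). -/
def uu : Fin 2 → MvPolynomial (Fin 2) ℂ := ![row 3 1, row (-1) 2]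
/-- tails `v = (t + e, t + 2e)`. -/
def vv : Fin 2 → MvPolynomial (Fin 2) ℂ := ![row 1 1, row 1 2]

/-- `C a · X₀^i · X₁^k` is the monomial `a·X^{(i,k)}`. -/
theorem C_mul_X_eq (a : ℂ) (i k : ℕ) :
    (C a * X 0 ^ i * X 1 ^ k : MvPolynomial (Fin 2) ℂ) = monomial (Finsupp.single 0 i + Finsupp.single 1 k) a := by
  rw [X_pow_eq_monomial, X_pow_eq_monomial, C_mul_monomial, monomial_mul]
  simp

/-- A row in `C · X₀^i X₁^k` form (for `ring`). -/
theorem row_eq (a b : ℂ) : row a b = C a * X 0 ^ 4 * X 1 ^ 4 + C b * X 0 ^ 8 * X 1 ^ 1 := by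
  rw [C_mul_X_eq, C_mul_X_eq]; rfl

/-- the tail difference of the instance: `2·X^{t+e} − 4·X^{2t}`. -/
theorem tailDiff_eq : tailDiff uu vv = monomial (et + ee) 2 - monomial pp 4 := by
  have h1 : tailDiff uu vv = (1 + row 3 1) * (1 + row (-1) 2) - (1 + row 1 1) * (1 + row 1 2) := by
    simp [tailDiff, uu, vv, Fin.prod_univ_two]
  have h2 : (1 + row 3 1) * (1 + row (-1) 2) - (1 + row 1 1) * (1 + row 1 2)
      = C 2 * X 0 ^ 12 * X 1 ^ 5 - C 4 * X 0 ^ 8 * X 1 ^ 8 := by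
    simp only [row_eq, map_neg, map_one, map_ofNat]
    ring
  have e1 : (Finsupp.single 0 12 + Finsupp.single 1 5 : Expo) = et + ee := by
    ext i; fin_cases i <;> simp [et, ee]
  have e2 : (Finsupp.single 0 8 + Finsupp.single 1 8 : Expo) = pp := by
    ext i; fin_cases i <;> simp [pp, et]
  rw [h1, h2, C_mul_X_eq, C_mul_X_eq, e1, e2]

/-- Coefficients of the tail difference. -/
theorem coeff_tailDiff (x : Expo) :
    coeff x (tailDiff uu vv) = (if et + ee = x then (2 : ℂ) else 0) - (if pp = x then (4 : ℂ) else 0) := by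
  rw [tailDiff_eq, coeff_sub, coeff_monomial, coeff_monomial]

/-- The support of the tail difference is `{t+e, 2t}`. -/
theorem mem_support_tailDiff {x : Expo} (hx : x ∈ (tailDiff uu vv).support) : x = et + ee ∨ x = pp := by
  rw [mem_support_iff, coeff_tailDiff] at hx
  by_contra h
  push Not at h
  apply hx
  simp [Ne.symm h.1, Ne.symm h.2]

/-- `p = 2t` carries the coefficient `−4 ≠ 0`. -/
theorem pp_mem_support : pp ∈ (tailDiff uu vv).support := by
  rw [mem_support_iff, coeff_tailDiff]
  simp [Ne.symm pp_ne_etee]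

/-- the exposing weight `ξ = (−1,−1)` (open negative quadrant). -/
def xi : Fin 2 → ℝ := ![-1, -1]

/-- `ξ₀ = −1`. -/
@[simp] theorem xi_zero : xi 0 = -1 := rfl
/-- `ξ₁ = −1`. -/
@[simp] theorem xi_one : xi 1 = -1 := rfl

/-- `wt ξ e = −(e₀ + e₁)`. -/
theorem wt_xi (e : Expo) : wt xi e = -(((e 0 : ℕ) : ℝ) + ((e 1 : ℕ) : ℝ)) := by
  unfold wt; simp; ring

/-- The support of a row is inside `{t, e}`. -/
theorem mem_support_row {a b : ℂ} {x : Expo} (hx : x ∈ (row a b).support) : x = et ∨ x = ee := by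
  rw [mem_support_iff, coeff_row] at hx
  by_contra h
  push Not at h
  apply hx
  simp [Ne.symm h.1, Ne.symm h.2]

/-- Row letters have negative `ξ`-weight. -/
theorem wt_row_neg {a b : ℂ} {x : Expo} (hx : x ∈ (row a b).support) : wt xi x < 0 := by
  rcases mem_support_row hx with rfl | rfl <;> (rw [wt_xi]; norm_num)

/-- `ξ` is a valid weight for the instance. -/
theorem validWeight_xi : ValidWeight uu vv xi := by
  refine ⟨fun j e he => ?_, fun j e he => ?_⟩ <;> fin_cases j <;> exact wt_row_neg (by simpa [uu, vv] using he)

/-- `p = 2t` is the strict `ξ`-top of the tail support (`−16 > −17`). -/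
theorem isStrictTop_pp : IsStrictTop xi (↑(tailDiff uu vv).support : Set Expo) pp := by
  refine ⟨by exact_mod_cast pp_mem_support, fun μ hμ hne => ?_⟩
  rcases mem_support_tailDiff (by exact_mod_cast hμ) with rfl | rfl
  · rw [wt_xi, wt_xi]; simp; norm_num
  · exact absurd rfl hne

/-- `p = (8,8)` is LL-visible. -/
theorem pp_mem_llVisible : pp ∈ llVisible uu vv :=
  ⟨xi, by simp, by simp, validWeight_xi, isStrictTop_pp⟩

/-- Truncation to the 3-digit box `[0,8)²` keeps exactly the letter `t`. -/
theorem boxTrunc_row (a b : ℂ) : boxTrunc 8 8 (row a b) = monomial et a := by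
  ext x
  rw [coeff_boxTrunc, coeff_row, coeff_monomial]
  by_cases h1 : et = x
  · subst h1; simp [Ne.symm et_ne_ee]
  · by_cases h2 : ee = x
    · subst h2; simp [h1]
    · simp [h1, h2]

/-- Truncated `u`-rows: `(3X^t, −X^t)`. -/
theorem boxTrunc_uu : (fun j => boxTrunc 8 8 (uu j)) = ![monomial et 3, monomial et (-1)] := by
  funext j; fin_cases j <;> simp [uu, boxTrunc_row]

/-- Truncated `v`-rows: `(X^t, X^t)`. -/
theorem boxTrunc_vv : (fun j => boxTrunc 8 8 (vv j)) = ![monomial et 1, monomial et 1] := by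
  funext j; fin_cases j <;> simp [vv, boxTrunc_row]

/-- The truncated rows of the two sides are NOT equal as multisets (not even up to scalars: `{3t, −t}` versus
`{t, t}`). -/
theorem truncated_rows_ne :
    (Finset.univ.val.map fun j => boxTrunc 8 8 (uu j)) ≠ (Finset.univ.val.map fun j => boxTrunc 8 8 (vv j)) := by
  rw [boxTrunc_uu, boxTrunc_vv]
  intro h
  have hmem : (monomial et (3 : ℂ) : MvPolynomial (Fin 2) ℂ) ∈
      (Finset.univ.val.map (![monomial et 1, monomial et 1] : Fin 2 → MvPolynomial (Fin 2) ℂ)) := by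
    rw [← h]; exact Multiset.mem_map.2 ⟨0, Finset.mem_univ_val 0, rfl⟩
  obtain ⟨j, -, hj⟩ := Multiset.mem_map.1 hmem
  have hc := congrArg (coeff et) hj
  fin_cases j <;> simp at hc

/-- `t ∈ A_4`. -/
theorem et_mem_digitGrid : et ∈ DigitGrid 4 := ⟨2, 2, by norm_num, by norm_num, by simp, by simp⟩
/-- `e ∈ A_4`. -/
theorem ee_mem_digitGrid : ee ∈ DigitGrid 4 := ⟨3, 0, by norm_num, by norm_num, by simp, by simp⟩

/-- Rows are supported on the digit grid `A_4`. -/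
theorem row_support_digitGrid {a b : ℂ} : ∀ e ∈ (row a b).support, e ∈ DigitGrid 4 := fun e he => by
  rcases mem_support_row he with rfl | rfl
  exacts [et_mem_digitGrid, ee_mem_digitGrid]

/-- `u` is supported on `A_4`. -/
theorem uu_digitGrid : ∀ j, ∀ e ∈ (uu j).support, e ∈ DigitGrid 4 := by
  intro j; fin_cases j <;> exact row_support_digitGrid

/-- `v` is supported on `A_4`. -/
theorem vv_digitGrid : ∀ j, ∀ e ∈ (vv j).support, e ∈ DigitGrid 4 := by
  intro j; fin_cases j <;> exact row_support_digitGrid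

/-- THE WITNESS (explicit, `s = 4`, `m = 2`, base 2): a digit-grid instance with an LL-visible point `p = (2³, 2³)` whose
3-digit identity box `[0,2³)²` has NON-coincident truncated rows (`{3·X^t, −X^t} ≠ {X^t, X^t}`, `t = (2²,2²)`). -/
theorem threeDigitBox_witness :
    (∀ j, ∀ e ∈ (uu j).support, e ∈ DigitGrid 4) ∧ (∀ j, ∀ e ∈ (vv j).support, e ∈ DigitGrid 4) ∧
    pp ∈ llVisible uu vv ∧ pp 0 = 2 ^ 3 ∧ pp 1 = 2 ^ 3 ∧
    (Finset.univ.val.map fun j => boxTrunc (2 ^ 3) (2 ^ 3) (uu j)) ≠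
      (Finset.univ.val.map fun j => boxTrunc (2 ^ 3) (2 ^ 3) (vv j)) :=
  ⟨uu_digitGrid, vv_digitGrid, pp_mem_llVisible, by simp, by simp, by
    rw [show (2 : ℕ) ^ 3 = 8 by norm_num]; exact truncated_rows_ne⟩

/-- Hence ROW COINCIDENCE BELOW LL-VISIBLE POINTS — the hypothesis `RowCoincidenceBelowLL` of the crux workfile's
`DigitGridLLLawGivenRigidity` (U1′), here UNFOLDED VERBATIM — is NOT a law of digit-grid (γ1) instances in base 2, already
at a 3-digit box. -/
theorem not_rowCoincidence_on_digitGrid :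
    ¬ (∀ (m s : ℕ) (u v : Fin m → MvPolynomial (Fin 2) ℂ),
        (∀ j, ∀ e ∈ (u j).support, e ∈ DigitGrid s) → (∀ j, ∀ e ∈ (v j).support, e ∈ DigitGrid s) →
        ∀ p ∈ llVisible u v, ∀ N M : ℕ, N ≤ p 0 + 1 → M ≤ p 1 + 1 → (N ≤ p 0 ∨ M ≤ p 1) →
          (Finset.univ.val.map fun j => boxTrunc N M (u j)) = (Finset.univ.val.map fun j => boxTrunc N M (v j))) :=
  fun h => truncated_rows_ne (h 2 4 uu vv uu_digitGrid vv_digitGrid pp pp_mem_llVisible 8 8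
    (by simp) (by simp) (Or.inl (by simp)))

end Summit.ValiantsHypothesis.ValiantsHypothesis.Theorems.NewtonUnitEquations.TwoProducts.Negative.RowCoincidence

end
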